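import Literature.Algebra.EuclideanLattices.MRGapCVPRunDOrder
import Literature.Computability.Cryptography.GuessedSISOracle
import Literature.Computability.Cryptography.SISCheckCodeFP
import Literature.Computability.Cryptography.CoinMatrixReaders
import Literature.Computability.Cryptography.SISOddPartMachine
import Literature.Computability.QuantumComplexity.PseudoGaussianSamplerMachine
import Literature.Computability.Complexity.CodeFPFinite
import HarnessLib

/-!
# One run of `W(B*, s)` of MR07 Thm. 5.23 as a coin-driven typed program, and its law in sampling order

Topic `Algebra/EuclideanLattices` (family `pqc`). `MRGapCVPRunDOrder.lean` describes one run of Micciancio–Regev's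
`W(B*, s)` (authors' version p. 29: sample `m` grid points, query the `SIS′` oracle on `A`, keep `u = x − ∑ zᵢyᵢ`
iff `z` solves `SIS′`) on the dual-grid data as the law

  `wAttemptWith B N S D O β ℓ : PMF (Option ℤⁿ)`  (noises `⨂ᵐ⨂ⁿ D`, boxes, `A = Amat K κ`, `z ∼ O(A)`),

for an ARBITRARY one-dimensional sampler law `D` and oracle kernel `O`. This file writes the run as a TYPED
PROGRAM on a coin word and proves that on uniform coins its law IS `wAttemptWith` with `D` the exact law of the
coin-driven sampler (`PGParams.lawPMF`) and `O` the guessed-coin kernel of the PPT solver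
(`GuessedCoinCall.guessKernel`). The two lattice-arithmetic maps of the run — the query `Amat` and the candidate
`uVec` of `DualGridAttemptSuccess.lean` — enter as ABSTRACT list programs `AmatL`, `uVecL` with a context `g`
(hypotheses `hA`, `hu` state their values on `ofFn` data; `hAfp`, `hufp` their polynomial time), so that the file
is independent of how that arithmetic is coded:

* `decodeL m w` — the oracle's answer read as a list (`= ofFn (decodeIntVec m w)`, `ofFn_decodeIntVec`),
  `decodeL_codeFP`;
* `wCore`, `wAttemptT` — the program: `K = readMat sampler`, `κ = readMat bitsToNat`, `A = AmatL g K κ`,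
  `w = callRun B Wg R (matQ n m q A) coins`, `z = decodeL m w`, output `some (uVecL g K κ z)` iff `sisCheckL`;
* **`wCore_codeFP`, `wAttemptT_codeFP`** — typed polynomial time in `(context, coins)`;
* **`map_wAttemptT_eq`** — on uniform coins of length `m n C_s + m n ℓ + (Wg + R)`:
  `law = (wAttemptWith B N S P.lawPMF (guessKernel B Wg R m) β ℓ).map (Option.map ofFn)`.

All proved; definitions with bodies; no named fact.

## References

* D. Micciancio, O. Regev, *Worst-case to average-case reductions based on Gaussian measures*, SIAM J. Comput.
  37 (2007) 267–302; authors' version, Thm. 5.23 (proof, step (2): the procedure `W(B*, s)`, p. 29), Lemma 5.7,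
  Thm. 5.9 (steps 2–4).
* S. Arora, B. Barak, *Computational Complexity: A Modern Approach*, CUP 2009, Def. 7.1, §7.4.1 [AroraBarak2009].
-/

noncomputable section

open scoped Classical ENNReal

namespace Literature.Algebra.EuclideanLattices

namespace DualGrid

open Literature.Computability.Complexity Literature.Computability.Complexity.CodeFP Literature.Computability.Complexity.LMat
  Literature.Computability.Cryptography Literature.Computability.Cryptography.SIS.OddPartFP
  Literature.Computability.Cryptography.GuessedCoinCall Literature.Computability.Cryptography.SISCheck
  Literature.Computability.Cryptography.CoinReaders Literature.Computability.QuantumComplexity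
  Literature.Probability.Distributions PMF Finset

/-! ### The oracle's answer as a list -/

/-- **The answer read as a list of `m` integers** (junk `0ᵐ` on malformed words or wrong dimension): the closed form
of `decodeIntVec`. [cite: AroraBarak2009, §0.1] -/
def decodeL (m : ℕ) (w : List Bool) : List ℤ :=
  if hdrOf w = m ∧ lenOf w = m then (List.range m).map fun i => (entriesOf (lenOf w) w).getD i 0
  else (List.range m).map fun _ => 0

/-- `decodeL m w = ofFn (decodeIntVec m w)`. [folklore] -/
theorem ofFn_decodeIntVec (m : ℕ) (w : List Bool) : List.ofFn (decodeIntVec m w) = decodeL m w := by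
  rw [decodeIntVec_eq, decodeL]
  by_cases h : hdrOf w = m ∧ lenOf w = m
  · rw [if_pos h, if_pos h, h.2, ← ofFn_eq_map_range'']
  · rw [if_neg h, if_neg h, ← ofFn_eq_map_range'']
    rfl

/-- **Reading the answer is typed polynomial time** (canonical re-encoding, then indexing). [cite: AroraBarak2009, §1.3] -/
theorem decodeL_codeFP : CodeFP (pairE unE strE) (rawE intE) (fun p => decodeL p.1 p.2) := by
  have hcanon : CodeFP strE (pairE natE (pairE unE (rawE smE))) (fun a => (hdrOf a, (lenOf a, entriesOf (lenOf a) a))) :=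
    ⟨canonIV, canonIV_mem_FP, fun a => canonIV_apply a⟩
  have hm : CodeFP (pairE unE strE) unE (fun p => p.1) := fst _ _
  have hdec : CodeFP (pairE unE strE) (pairE natE (pairE unE (rawE smE))) (fun p => (hdrOf p.2, (lenOf p.2, entriesOf (lenOf p.2) p.2))) :=
    (hcanon.comp (snd _ _) :)
  have hes : CodeFP (pairE unE strE) (rawE intE) (fun p => entriesOf (lenOf p.2) p.2) :=
    (((map₀ intOfSM).comp hdec.snd'.snd') :).congr fun p => by simp
  have hh : CodeFP (pairE unE strE) bitE (fun p => decide (hdrOf p.2 = p.1)) := (natEq.comp (hdec.fst'.pair (natOfUn.comp hm)) :)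
  have hl : CodeFP (pairE unE strE) bitE (fun p => decide (lenOf p.2 = p.1)) :=
    (natEq.comp ((natOfUn.comp hdec.snd'.fst').pair (natOfUn.comp hm)) :)
  have hitem : CodeFP (pairE (rawE intE) natE) intE (fun t => t.1.getD t.2 0) :=
    ((rawGetOr intE).comp ((fst _ _).pair ((snd _ _).pair (const _ (0 : ℤ)))) :)
  have hsome : CodeFP (pairE unE strE) (rawE intE) (fun p => (List.range p.1).map fun i => (entriesOf (lenOf p.2) p.2).getD i 0) :=
    ((map hitem).comp (hes.pair (urange.comp hm)) :)
  have hzero : CodeFP (pairE unE strE) (rawE intE) (fun p => (List.range p.1).map fun _ => (0 : ℤ)) :=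
    ((map (σ := Unit) (eσ := unitE) (eα := natE) (eβ := intE) (g := fun _ : Unit × ℕ => (0 : ℤ)) (const _ (0 : ℤ))).comp
      ((const _ ()).pair (urange.comp hm)) :)
  have h := (ite (hh.and hl) hsome hzero :)
  refine h.congr fun p => ?_
  obtain ⟨m, w⟩ := p
  simp only [decodeL, Bool.and_eq_true, decide_eq_true_eq]

/-! ### The program -/

section Program

variable {γ : Type} (AmatL : γ → List (List ℤ) → List (List ℤ) → List (List ℤ))
  (uVecL : γ → List (List ℤ) → List (List ℤ) → List ℤ → List ℤ) (B : RandAlg (List Bool) (List Bool))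

/-- The run's numeric parameters `(n, m, q, (num, den), ℓ, Wg, R, C_s)` (`β = num/den`; `C_s` the sampler's
coin length; `Wg`, `R` the guess width and supply of the oracle call). [folklore] -/
abbrev WParams : Type := ℕ × (ℕ × (ℕ × ((ℤ × ℕ) × (ℕ × (ℕ × (ℕ × ℕ))))))

namespace WParams
variable (w : WParams)
/-- `n`. -/ abbrev n : ℕ := w.1
/-- `m`. -/ abbrev m : ℕ := w.2.1
/-- `q`. -/ abbrev q : ℕ := w.2.2.1
/-- `num`. -/ abbrev num : ℤ := w.2.2.2.1.1
/-- `den`. -/ abbrev den : ℕ := w.2.2.2.1.2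
/-- `ℓ`. -/ abbrev ll : ℕ := w.2.2.2.2.1
/-- `Wg`. -/ abbrev wg : ℕ := w.2.2.2.2.2.1
/-- `R`. -/ abbrev rr : ℕ := w.2.2.2.2.2.2.1
/-- `C_s`. -/ abbrev cs : ℕ := w.2.2.2.2.2.2.2
end WParams

/-- The code of the parameters: `n, m` unary, `q` binary, `num` (difference pair), `den` binary, `ℓ, Wg, R, C_s` unary. [folklore] -/
abbrev wParamsE : WParams → List Bool :=
  pairE unE (pairE unE (pairE natE (pairE (pairE intE natE) (pairE unE (pairE unE (pairE unE unE))))))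

/-- The run after the two tables have been read: query, call, answer, test, candidate.
[cite: MicciancioRegev2007, Thm. 5.23 (proof, step (2), p. 29)] -/
def wCore (g : γ) (w : WParams) (K κ : List (List ℤ)) (rO : List Bool) : Option (List ℤ) :=
  if sisCheckL w.q w.m w.num w.den (AmatL g K κ) (decodeL w.m (callRun B w.wg w.rr (matQ w.n w.m w.q (AmatL g K κ)) rO)) then
    some (uVecL g K κ (decodeL w.m (callRun B w.wg w.rr (matQ w.n w.m w.q (AmatL g K κ)) rO)))
  else none

/-- **One run of `W` as a typed program on its coin word** `r = r_K ++ r_κ ++ r_O` (noise table from the first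
`m n C_s` coins, box table from the next `m n ℓ`, oracle call on the rest).
[cite: MicciancioRegev2007, Thm. 5.23 (proof, step (2): `W(B*, s)`, p. 29)] -/
def wAttemptT (g : γ) (c : SamplerCtx) (w : WParams) (r : List Bool) : Option (List ℤ) :=
  wCore AmatL uVecL B g w (readMat (samplerOf c) w.cs w.n w.m r)
    (readMat (fun v => (bitsToNat v : ℤ)) w.ll w.n w.m (r.drop (w.m * w.n * w.cs)))
    (r.drop (w.m * w.n * w.cs + w.m * w.n * w.ll))

variable {eγ : γ → List Bool}

/-- The code of the program's arguments: `⟨⟨g, ⟨sampler record, parameters⟩⟩, coins⟩`. [folklore] -/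
abbrev wArgE (eγ : γ → List Bool) : (γ × (SamplerCtx × WParams)) × List Bool → List Bool :=
  pairE (pairE eγ (pairE samplerCtxE wParamsE)) strE

/-- The code of the core's arguments: `⟨g, ⟨parameters, ⟨K, ⟨κ, r_O⟩⟩⟩⟩`. [folklore] -/
abbrev wCoreE (eγ : γ → List Bool) : γ × (WParams × (List (List ℤ) × (List (List ℤ) × List Bool))) → List Bool :=
  pairE eγ (pairE wParamsE (pairE matE (pairE matE strE)))

/-- **The core is typed polynomial time.** [cite: AroraBarak2009, §1.3] -/
theorem wCore_codeFP (hAfp : CodeFP (pairE eγ (pairE matE matE)) matE (fun t => AmatL t.1 t.2.1 t.2.2))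
    (hufp : CodeFP (pairE eγ (pairE matE (pairE matE (rawE intE)))) (rawE intE) (fun t => uVecL t.1 t.2.1 t.2.2.1 t.2.2.2))
    (hB : IsPPT B id) :
    CodeFP (wCoreE eγ) (optE (rawE intE)) (fun p => wCore AmatL uVecL B p.1 p.2.1 p.2.2.1 p.2.2.2.1 p.2.2.2.2) := by
  have hg : CodeFP (wCoreE eγ) eγ (fun p => p.1) := fst _ _
  have hw : CodeFP (wCoreE eγ) wParamsE (fun p => p.2.1) := (snd _ _).fst'
  have hK : CodeFP (wCoreE eγ) matE (fun p => p.2.2.1) := (snd _ _).snd'.fst'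
  have hκ : CodeFP (wCoreE eγ) matE (fun p => p.2.2.2.1) := (snd _ _).snd'.snd'.fst'
  have hrO : CodeFP (wCoreE eγ) strE (fun p => p.2.2.2.2) := (snd _ _).snd'.snd'.snd'
  have hn : CodeFP (wCoreE eγ) unE (fun p => p.2.1.n) := hw.fst'
  have hm : CodeFP (wCoreE eγ) unE (fun p => p.2.1.m) := hw.snd'.fst'
  have hq : CodeFP (wCoreE eγ) natE (fun p => p.2.1.q) := hw.snd'.snd'.fst'
  have hnum : CodeFP (wCoreE eγ) intE (fun p => p.2.1.num) := hw.snd'.snd'.snd'.fst'.fst'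
  have hden : CodeFP (wCoreE eγ) natE (fun p => p.2.1.den) := hw.snd'.snd'.snd'.fst'.snd'
  have hwg : CodeFP (wCoreE eγ) unE (fun p => p.2.1.wg) := hw.snd'.snd'.snd'.snd'.snd'.fst'
  have hrr : CodeFP (wCoreE eγ) unE (fun p => p.2.1.rr) := hw.snd'.snd'.snd'.snd'.snd'.snd'.fst'
  have hA : CodeFP (wCoreE eγ) matE (fun p => AmatL p.1 p.2.2.1 p.2.2.2.1) := (hAfp.comp (hg.pair (hK.pair hκ)) :)
  have hquery : CodeFP (wCoreE eγ) strE (fun p => matQ p.2.1.n p.2.1.m p.2.1.q (AmatL p.1 p.2.2.1 p.2.2.2.1)) :=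
    (matQ_codeFP.comp ((natOfUn.comp hn).pair ((natOfUn.comp hm).pair (hq.pair hA))) :)
  have hcall : CodeFP (wCoreE eγ) strE (fun p => callRun B p.2.1.wg p.2.1.rr (matQ p.2.1.n p.2.1.m p.2.1.q (AmatL p.1 p.2.2.1 p.2.2.2.1)) p.2.2.2.2) :=
    ((callRun_codeFP hB).comp ((hwg.pair hrr).pair (hquery.pair hrO)) :)
  have hz : CodeFP (wCoreE eγ) (rawE intE)
      (fun p => decodeL p.2.1.m (callRun B p.2.1.wg p.2.1.rr (matQ p.2.1.n p.2.1.m p.2.1.q (AmatL p.1 p.2.2.1 p.2.2.2.1)) p.2.2.2.2)) :=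
    (decodeL_codeFP.comp (hm.pair hcall) :)
  have hchk := (sisCheckL_codeFP.comp ((hq.pair (hm.pair (hnum.pair hden))).pair (hA.pair hz)) :)
  have hu := (hufp.comp (hg.pair (hK.pair (hκ.pair hz))) :)
  have hnone : CodeFP (wCoreE eγ) (optE (rawE intE)) (fun _ => none) := const _ none
  have h := (ite hchk ((optSome (rawE intE)).comp hu) hnone :)
  exact h.congr fun p => rfl

/-- **The run is typed polynomial time** given the two lattice-arithmetic programs and a PPT solver.
[cite: AroraBarak2009, §1.3; MicciancioRegev2007, Thm. 5.23 (proof: "W runs in polynomial time")] -/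
theorem wAttemptT_codeFP (hAfp : CodeFP (pairE eγ (pairE matE matE)) matE (fun t => AmatL t.1 t.2.1 t.2.2))
    (hufp : CodeFP (pairE eγ (pairE matE (pairE matE (rawE intE)))) (rawE intE) (fun t => uVecL t.1 t.2.1 t.2.2.1 t.2.2.2))
    (hB : IsPPT B id) :
    CodeFP (wArgE eγ) (optE (rawE intE)) (fun p => wAttemptT AmatL uVecL B p.1.1 p.1.2.1 p.1.2.2 p.2) := by
  have hg : CodeFP (wArgE eγ) eγ (fun p => p.1.1) := (fst _ _).fst'
  have hc : CodeFP (wArgE eγ) samplerCtxE (fun p => p.1.2.1) := (fst _ _).snd'.fst'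
  have hw : CodeFP (wArgE eγ) wParamsE (fun p => p.1.2.2) := (fst _ _).snd'.snd'
  have hr : CodeFP (wArgE eγ) strE (fun p => p.2) := snd _ _
  have hn : CodeFP (wArgE eγ) unE (fun p => p.1.2.2.n) := hw.fst'
  have hm : CodeFP (wArgE eγ) unE (fun p => p.1.2.2.m) := hw.snd'.fst'
  have hq : CodeFP (wArgE eγ) natE (fun p => p.1.2.2.q) := hw.snd'.snd'.fst'
  have hnum : CodeFP (wArgE eγ) intE (fun p => p.1.2.2.num) := hw.snd'.snd'.snd'.fst'.fst'
  have hden : CodeFP (wArgE eγ) natE (fun p => p.1.2.2.den) := hw.snd'.snd'.snd'.fst'.snd'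
  have hll : CodeFP (wArgE eγ) unE (fun p => p.1.2.2.ll) := hw.snd'.snd'.snd'.snd'.fst'
  have hwg : CodeFP (wArgE eγ) unE (fun p => p.1.2.2.wg) := hw.snd'.snd'.snd'.snd'.snd'.fst'
  have hrr : CodeFP (wArgE eγ) unE (fun p => p.1.2.2.rr) := hw.snd'.snd'.snd'.snd'.snd'.snd'.fst'
  have hcs : CodeFP (wArgE eγ) unE (fun p => p.1.2.2.cs) := hw.snd'.snd'.snd'.snd'.snd'.snd'.snd'
  -- lengths and coin segments
  have hLK : CodeFP (wArgE eγ) unE (fun p => p.1.2.2.m * p.1.2.2.n * p.1.2.2.cs) := (unMul'.comp ((unMul'.comp (hm.pair hn)).pair hcs) :)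
  have hLκ : CodeFP (wArgE eγ) unE (fun p => p.1.2.2.m * p.1.2.2.n * p.1.2.2.ll) := (unMul'.comp ((unMul'.comp (hm.pair hn)).pair hll) :)
  have hrκ : CodeFP (wArgE eγ) strE (fun p => p.2.drop (p.1.2.2.m * p.1.2.2.n * p.1.2.2.cs)) := (strDrop.comp (hLK.pair hr) :)
  have hrO : CodeFP (wArgE eγ) strE (fun p => p.2.drop (p.1.2.2.m * p.1.2.2.n * p.1.2.2.cs + p.1.2.2.m * p.1.2.2.n * p.1.2.2.ll)) :=
    (strDrop.comp ((unAdd.comp (hLK.pair hLκ)).pair hr) :)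
  -- the two tables
  have hK : CodeFP (wArgE eγ) matE (fun p => readMat (samplerOf p.1.2.1) p.1.2.2.cs p.1.2.2.n p.1.2.2.m p.2) :=
    ((readMat_codeFP (f := fun (c : SamplerCtx) v => samplerOf c v) samplerOf_codeFP).comp (hc.pair ((hcs.pair (hn.pair hm)).pair hr)) :)
  have hval : CodeFP (pairE unitE strE) intE (fun t => (bitsToNat t.2 : ℤ)) := (intOfNat.comp (strVal.comp (snd _ _)) :)
  have hκ : CodeFP (wArgE eγ) matE (fun p => readMat (fun v => (bitsToNat v : ℤ)) p.1.2.2.ll p.1.2.2.n p.1.2.2.m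
      (p.2.drop (p.1.2.2.m * p.1.2.2.n * p.1.2.2.cs))) :=
    ((readMat_codeFP (f := fun (_ : Unit) v => (bitsToNat v : ℤ)) hval).comp ((const _ ()).pair ((hll.pair (hn.pair hm)).pair hrκ)) :)
  -- the core on `(g, w, K, κ, rO)`
  have hcore := (wCore_codeFP AmatL uVecL B hAfp hufp hB).comp (hg.pair (hw.pair (hK.pair (hκ.pair hrO))))
  exact hcore.congr fun p => rfl

end Program

/-! ### The law on uniform coins -/

section Law

variable {γ : Type} {AmatL : γ → List (List ℤ) → List (List ℤ) → List (List ℤ)}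
  {uVecL : γ → List (List ℤ) → List (List ℤ) → List ℤ → List ℤ} {B : RandAlg (List Bool) (List Bool)}

/-- The rows of a table of integer vectors. [folklore] -/
abbrev rowsL {n m : ℕ} (K : Fin m → Fin n → ℤ) : List (List ℤ) := List.ofFn fun i => List.ofFn (K i)

/-- **A call on a long enough uniform segment has the law `callLaw`** (only the first `Wg + R` coins are read).
[cite: AroraBarak2009, Def. 7.1] -/
theorem map_callRun_eq_callLaw (Wg R : ℕ) (x : List Bool) {Lr : ℕ} (h : Wg + R ≤ Lr) :
    (uniformOfFintype (List.Vector Bool Lr)).map (fun b => callRun B Wg R x b.toList) = callLaw B Wg R x := by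
  have h1 : (fun b : List.Vector Bool Lr => callRun B Wg R x b.toList) =
      (fun v : List.Vector Bool (Wg + R) => callRun B Wg R x v.toList) ∘ (fun b => (vecSplit (Wg + R) Lr h b).1) := by
    funext b
    simp only [Function.comp_apply]
    rw [← callRun_take x b.toList]
    rfl
  rw [h1, ← PMF.map_comp, uniformVector_map_take h, callLaw]

variable {n m : ℕ} (B₀ : Matrix (Fin n) (Fin n) ℤ) (N : ℕ) (S : Fin n → Fin n → ℤ) (q : ℕ) [NeZero q]
  (g : γ)
  (hA : ∀ K κ : Fin m → Fin n → ℤ,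
    AmatL g (rowsL K) (rowsL κ) = List.ofFn fun j => List.ofFn fun i => (((Amat B₀ N S q K κ) j i).val : ℤ))
  (hu : ∀ (K κ : Fin m → Fin n → ℤ) (z : Fin m → ℤ), uVecL g (rowsL K) (rowsL κ) (List.ofFn z) = List.ofFn (uVec B₀ N S q K κ z))

include hA hu in
/-- **The core on `ofFn` data is the idealised step with the list reading**: query code `= encodeMatrix (Amat K κ)`,
test `= IsSolution'`, candidate `= uVec`. [cite: MicciancioRegev2007, Thm. 5.23 (proof, step (2), p. 29)] -/
theorem wCore_rowsOf (d : ℚ) (ℓ Wg R cs : ℕ) (K κ : Fin m → Fin n → ℤ) (rO : List Bool) :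
    wCore AmatL uVecL B g (n, (m, (q, ((d.num, d.den), (ℓ, (Wg, (R, cs))))))) (rowsL K) (rowsL κ) rO =
      (if SIS.IsSolution' (Amat B₀ N S q K κ) (d : ℝ)
          (decodeIntVec m (callRun B Wg R (SIS.encodeMatrix (Amat B₀ N S q K κ)) rO)) then
        some (uVec B₀ N S q K κ (decodeIntVec m (callRun B Wg R (SIS.encodeMatrix (Amat B₀ N S q K κ)) rO))) else none).map
        fun v => List.ofFn v := by
  simp only [wCore, WParams.n, WParams.m, WParams.q, WParams.num, WParams.den, WParams.wg, WParams.rr, hA,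
    ← encodeMatrix_eq_matQ, ← ofFn_decodeIntVec, sisCheckL_ofFn_iff]
  by_cases h : SIS.IsSolution' (Amat B₀ N S q K κ) (d : ℝ) (decodeIntVec m (callRun B Wg R (SIS.encodeMatrix (Amat B₀ N S q K κ)) rO))
  · rw [if_pos h, if_pos h, Option.map_some, hu]
  · rw [if_neg h, if_neg h, Option.map_none]

omit [NeZero q] in
/-- `gridNoiseWith D 0 = ⨂ⁿ D`. [folklore] -/
theorem gridNoiseWith_zero' (D : PMF ℤ) : gridNoiseWith D (0 : Fin n → ℤ) = indepLaw n fun _ => D := by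
  rw [gridNoiseWith]
  have : (fun x : Fin n → ℤ => x + 0) = id := funext fun x => add_zero x
  rw [this, PMF.map_id]

omit [NeZero q] in
/-- Reading a table ignores coins beyond the first `n C m`. [folklore] -/
theorem readMat_take {α : Type} (f : List Bool → α) (C n' m' : ℕ) (r : List Bool) {Lt : ℕ} (h : n' * C * m' ≤ Lt) :
    readMat f C n' m' (r.take Lt) = readMat f C n' m' r := by
  unfold readMat
  refine List.map_congr_left fun i hi => ?_
  rw [List.mem_range] at hi
  have hc : chunk (n' * C) (r.take Lt) i = chunk (n' * C) r i := by
    rw [chunk, chunk, List.drop_take, List.take_take, min_eq_left]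
    have : n' * C * (i + 1) ≤ Lt := (Nat.mul_le_mul_left _ hi).trans h
    rw [Nat.mul_succ] at this
    omega
  rw [hc]

include hA hu in
/-- **The law of the program on uniform coins is `wAttemptWith`** with the sampler's exact law and the guessed-coin
oracle kernel (read through `ofFn`): for coins of any length `L ≥ m n C_s + m n ℓ + (Wg + R)`.
[cite: MicciancioRegev2007, Thm. 5.23 (proof, step (2): `W(B*, s)`, p. 29); AroraBarak2009, Def. 7.1] -/
theorem map_wAttemptT_eq (d : ℚ) (ℓ Wg R : ℕ) (P : PGParams) {L : ℕ} (hL : m * n * P.coinLen + m * n * ℓ + (Wg + R) ≤ L) :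
    (uniformOfFintype (List.Vector Bool L)).map
        (fun r => wAttemptT AmatL uVecL B g P.ctx (n, (m, (q, ((d.num, d.den), (ℓ, (Wg, (R, P.coinLen))))))) r.toList) =
      (wAttemptWith B₀ N S (q := q) P.lawPMF (guessKernel B Wg R m) (d : ℝ) ℓ).map (Option.map fun v => List.ofFn v) := by
  classical
  set LK := m * n * P.coinLen with hLK
  set Lκ := m * n * ℓ with hLκ
  set w : WParams := (n, (m, (q, ((d.num, d.den), (ℓ, (Wg, (R, P.coinLen))))))) with hw
  have hLK_le : LK ≤ L := by omega
  have hLκ_le : Lκ ≤ L - LK := by omega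
  have hLO : Wg + R ≤ L - LK - Lκ := by omega
  have hK_le : n * P.coinLen * m ≤ LK := by rw [hLK]; exact le_of_eq (by ring)
  have hκ_le : n * ℓ * m ≤ Lκ := by rw [hLκ]; exact le_of_eq (by ring)
  -- the program through the two splits
  set fK : List.Vector Bool LK → List (List ℤ) := fun a => readMat (samplerOf P.ctx) P.coinLen n m a.toList with hfK
  set fκ : List.Vector Bool Lκ → List (List ℤ) := fun b => readMat (fun v => (bitsToNat v : ℤ)) ℓ n m b.toList with hfκ
  set G : List (List ℤ) → List (List ℤ) → List Bool → Option (List ℤ) := fun K κ rO => wCore AmatL uVecL B g w K κ rO with hG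
  have hprog : (fun r : List.Vector Bool L => wAttemptT AmatL uVecL B g P.ctx w r.toList) =
      (fun ab : List.Vector Bool LK × List.Vector Bool (L - LK) =>
        (fun bc : List.Vector Bool Lκ × List.Vector Bool (L - LK - Lκ) => G (fK ab.1) (fκ bc.1) bc.2.toList)
          (vecSplit Lκ (L - LK) hLκ_le ab.2)) ∘ vecSplit LK L hLK_le := by
    funext r
    simp only [Function.comp_apply, hG, hfK, hfκ, wAttemptT]
    have h1 : (vecSplit LK L hLK_le r).1.toList = r.toList.take LK := rfl
    have h2 : (vecSplit Lκ (L - LK) hLκ_le (vecSplit LK L hLK_le r).2).1.toList = (r.toList.drop LK).take Lκ := rfl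
    have h3 : (vecSplit Lκ (L - LK) hLκ_le (vecSplit LK L hLK_le r).2).2.toList = (r.toList.drop LK).drop Lκ := rfl
    rw [h1, h2, h3, readMat_take _ _ _ _ _ hK_le, readMat_take _ _ _ _ _ hκ_le, List.drop_drop]
  -- the law of the pieces
  have hlawK : (uniformOfFintype (List.Vector Bool LK)).map fK =
      (indepLaw m fun _ => indepLaw n fun _ => P.lawPMF).map fun K => rowsL K := by
    rw [hfK, map_readMat_eq _ _ _ _ hK_le]
    have hs : (fun v : List.Vector Bool P.coinLen => samplerOf P.ctx v.toList) = fun v => P.samplerFlat v.toList :=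
      funext fun v => samplerOf_ctx P v.toList
    rw [hs, Literature.Computability.Cryptography.PGParams.uniformVector_map_samplerFlat_eq_lawPMF P]
  have hlawκ : (uniformOfFintype (List.Vector Bool Lκ)).map fκ = (indepLaw m fun _ => boxLaw n ℓ).map fun K => rowsL K := by
    rw [hfκ, map_readMat_eq _ _ _ _ hκ_le, indepLaw_bitsToNat_eq_box]
    rfl
  have hlawO : ∀ x : List Bool, (uniformOfFintype (List.Vector Bool (L - LK - Lκ))).map (fun c => callRun B Wg R x c.toList) =
      callLaw B Wg R x := fun x => map_callRun_eq_callLaw Wg R x hLO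
  -- assemble
  rw [hprog, ← PMF.map_comp, uniformVector_map_vecSplit, uniformOfFintype_prod_eq_bind, PMF.map_bind]
  simp only [PMF.map_comp, Function.comp_def]
  have hinner : ∀ a : List.Vector Bool LK,
      (uniformOfFintype (List.Vector Bool (L - LK))).map
          (fun b => G (fK a) (fκ (vecSplit Lκ (L - LK) hLκ_le b).1) (vecSplit Lκ (L - LK) hLκ_le b).2.toList) =
        ((uniformOfFintype (List.Vector Bool Lκ)).map fκ).bind fun κ =>
          (uniformOfFintype (List.Vector Bool (L - LK - Lκ))).map fun c => G (fK a) κ c.toList := by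
    intro a
    have h1 : (fun b : List.Vector Bool (L - LK) => G (fK a) (fκ (vecSplit Lκ (L - LK) hLκ_le b).1) (vecSplit Lκ (L - LK) hLκ_le b).2.toList) =
        (fun bc : List.Vector Bool Lκ × List.Vector Bool (L - LK - Lκ) => G (fK a) (fκ bc.1) bc.2.toList) ∘ vecSplit Lκ (L - LK) hLκ_le := by
      funext b; rfl
    rw [h1, ← PMF.map_comp, uniformVector_map_vecSplit, uniformOfFintype_prod_eq_bind, PMF.map_bind, PMF.bind_map]
    simp only [PMF.map_comp, Function.comp_def]
  simp_rw [hinner]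
  -- replace the uniform segments by their laws
  have hstep : ((uniformOfFintype (List.Vector Bool LK)).bind fun a =>
        ((uniformOfFintype (List.Vector Bool Lκ)).map fκ).bind fun κ =>
          (uniformOfFintype (List.Vector Bool (L - LK - Lκ))).map fun c => G (fK a) κ c.toList) =
      ((uniformOfFintype (List.Vector Bool LK)).map fK).bind fun K =>
        ((uniformOfFintype (List.Vector Bool Lκ)).map fκ).bind fun κ =>
          (uniformOfFintype (List.Vector Bool (L - LK - Lκ))).map fun c => G K κ c.toList := by
    rw [PMF.bind_map]
    rfl
  rw [hstep, hlawK, hlawκ]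
  simp only [PMF.bind_map, Function.comp_def]
  -- the right-hand side
  rw [wAttemptWith, gridNoiseWith_zero', PMF.map_bind]
  refine congrArg _ (funext fun K => ?_)
  rw [PMF.map_bind]
  refine congrArg _ (funext fun κ => ?_)
  -- one (K, κ): the call and the reading
  have hGK : ∀ c : List.Vector Bool (L - LK - Lκ), G (rowsL K) (rowsL κ) c.toList =
      ((fun z : Fin m → ℤ => (if SIS.IsSolution' (Amat B₀ N S q K κ) (d : ℝ) z then some (uVec B₀ N S q K κ z) else none).map
          fun v => List.ofFn v) ∘ decodeIntVec m ∘ fun c : List.Vector Bool (L - LK - Lκ) =>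
            callRun B Wg R (SIS.encodeMatrix (Amat B₀ N S q K κ)) c.toList) c := by
    intro c
    rw [hG]
    exact wCore_rowsOf B₀ N S q g hA hu d ℓ Wg R P.coinLen K κ c.toList
  simp_rw [hGK]
  rw [← PMF.map_comp, ← PMF.map_comp, hlawO, guessKernel, PMF.map_comp, PMF.map_comp, PMF.map_comp]
  rfl

end Law

end DualGrid

end Literature.Algebra.EuclideanLattices

end
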